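import Literature.AlgebraicTopology.KTheory.MappingCone
import Literature.AlgebraicTopology.KTheory.MappingConeK
import Literature.AlgebraicTopology.KTheory.SphereSmash
import Literature.AlgebraicTopology.KTheory.ClutchingStablyTrivial
import Literature.AlgebraicTopology.KTheory.ReducedSphereVanishing
import Literature.AlgebraicTopology.KTheory.HomotopyInvariance
import Mathlib.Analysis.Normed.Module.Ball.Homeomorph
import Mathlib.Analysis.Normed.Module.Connected
import HarnessLib

/-!
# Sphere models for the mapping cone: radial homeomorphisms, `K̃(∂(Dᵈ × Dᵈ)) = 0`, stable null-homotopy on `Sᵈ`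

Plumbing between the spheres occurring in the mapping cone of the Hopf construction
(`MappingCone.lean`: the boundary `∂(Dᵈ × Dᵈ)` of the bidisc, the bottom sphere
`Sᵈ ⊆ ℝᵈ × ℝ`, the top cell `(Dᵈ × Dᵈ)/∂`) and the round spheres
`Sⁿ ⊆ EuclideanSpace ℝ (Fin (n + 1))` for which `K̃` is computed in the tree. All proved:

* §1 radial projection: unit spheres of real normed spaces related by a continuous linear
  equivalence are homeomorphic (`sphereHomeoOfEquiv`); re-dimensioning `sphereCastHomeo`;
* §2 base-point independence of the reduced group on path-connected spaces
  (`reduced_eq_of_joined`: the two point inclusions are homotopic);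
* §3 `∂(Dᵈ × Dᵈ) ≃ₜ S²ᵈ⁻¹` (`bdryHomeoRound`) and **`K̃(∂(Dᵈ × Dᵈ)) = 0`** for `d ≥ 1`
  (`reduced_bdry_eq_bot`, from `K̃(S^{odd}) = 0`);
* §4 `Sᵈ ≃ₜ` round `Sᵈ ≃ₜ` the equator of `Sᵈ⁺¹` and **stable null-homotopy of invertible
  matrix-valued maps on `Sᵈ` for `d` even** (`stablyNullhomotopic_even`, from
  `ClutchingStablyTrivial.lean` and `K̃(Sᵈ⁺¹) = 0`);
* §5 the top cell: **`(Dᵈ × Dᵈ)/∂ ≃ₜ S²ᵈ`** with base point to the pole (`topCellHomeo`), via the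
  one-point compactification of the open bidisc.

## References

* A. Hatcher, *Vector Bundles and K-Theory* (v2.2, 2017), §2.3 (proof of Thm. 2.19: the spaces
  `C_f/S²ⁿ = S⁴ⁿ`, `∂(D²ⁿ × D²ⁿ) = S⁴ⁿ⁻¹`), Prop. 1.11. [HatcherVBKT2017]
* A. Hatcher, *Algebraic Topology* (2002), Ch. 0 (cells and spheres). [HatcherAT2002]
-/

noncomputable section

namespace Literature.AlgebraicTopology.KTheory

open Literature.RingTheory.KTheory Set Metric TopologicalSpace Filter Topology Module

/-! ### 1. Radial homeomorphisms of unit spheres -/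

section Radial

variable {E F : Type*} [NormedAddCommGroup E] [NormedSpace ℝ E] [NormedAddCommGroup F] [NormedSpace ℝ F]

/-- The normalisation `v/|v|`. [folklore] -/
def nrmz (v : E) : E := ‖v‖⁻¹ • v

/-- Sphere models (Hatcher VBKT §2.3). [folklore] -/
theorem norm_nrmz {v : E} (hv : v ≠ 0) : ‖nrmz v‖ = 1 := by
  rw [nrmz, norm_smul, norm_inv, norm_norm, inv_mul_cancel₀ (norm_ne_zero_iff.2 hv)]

/-- Sphere models (Hatcher VBKT §2.3). [folklore] -/
theorem nrmz_smul {c : ℝ} (hc : 0 < c) (v : E) : nrmz (c • v) = nrmz v := by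
  rcases eq_or_ne v 0 with rfl | hv
  · simp [nrmz]
  · rw [nrmz, nrmz, norm_smul, Real.norm_of_nonneg hc.le, smul_smul, mul_inv, mul_comm c⁻¹, mul_assoc, inv_mul_cancel₀ hc.ne', mul_one]

/-- Sphere models (Hatcher VBKT §2.3). [folklore] -/
theorem nrmz_of_norm_eq_one {v : E} (hv : ‖v‖ = 1) : nrmz v = v := by rw [nrmz, hv, inv_one, one_smul]

omit [NormedSpace ℝ E] in
/-- Sphere models (Hatcher VBKT §2.3). [folklore] -/
theorem ne_zero_of_mem_unitSphere (x : sphere (0 : E) 1) : (x : E) ≠ 0 :=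
  fun h ↦ by have := mem_sphere_zero_iff_norm.1 x.2; rw [h, norm_zero] at this; exact zero_ne_one this

/-- **Radial projection**: unit spheres of normed spaces related by a continuous linear
equivalence are homeomorphic, `x ↦ L x / |L x|`. [folklore] -/
def sphereHomeoOfEquiv (L : E ≃L[ℝ] F) : sphere (0 : E) 1 ≃ₜ sphere (0 : F) 1 where
  toFun x := ⟨nrmz (L x), mem_sphere_zero_iff_norm.2 (norm_nrmz (by simpa using ne_zero_of_mem_unitSphere x))⟩
  invFun y := ⟨nrmz (L.symm y), mem_sphere_zero_iff_norm.2 (norm_nrmz (by simpa using ne_zero_of_mem_unitSphere y))⟩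
  left_inv x := by
    apply Subtype.ext
    change nrmz (L.symm (nrmz (L x))) = x
    rw [show nrmz (L x) = ‖L x‖⁻¹ • L x from rfl, L.symm.map_smul, L.symm_apply_apply,
      nrmz_smul (inv_pos.2 (norm_pos_iff.2 (by simpa using ne_zero_of_mem_unitSphere x))), nrmz_of_norm_eq_one (mem_sphere_zero_iff_norm.1 x.2)]
  right_inv y := by
    apply Subtype.ext
    change nrmz (L (nrmz (L.symm y))) = y
    rw [show nrmz (L.symm y) = ‖L.symm y‖⁻¹ • L.symm y from rfl, L.map_smul, L.apply_symm_apply,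
      nrmz_smul (inv_pos.2 (norm_pos_iff.2 (by simpa using ne_zero_of_mem_unitSphere y))), nrmz_of_norm_eq_one (mem_sphere_zero_iff_norm.1 y.2)]
  continuous_toFun := by
    refine Continuous.subtype_mk ?_ _
    have h1 : Continuous fun x : sphere (0 : E) 1 ↦ L x := L.continuous.comp continuous_subtype_val
    exact ((continuous_norm.comp h1).inv₀ (fun x ↦ norm_ne_zero_iff.2 (by simpa using ne_zero_of_mem_unitSphere x))).smul h1
  continuous_invFun := by
    refine Continuous.subtype_mk ?_ _
    have h1 : Continuous fun y : sphere (0 : F) 1 ↦ L.symm y := L.symm.continuous.comp continuous_subtype_val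
    exact ((continuous_norm.comp h1).inv₀ (fun y ↦ norm_ne_zero_iff.2 (by simpa using ne_zero_of_mem_unitSphere y))).smul h1

/-- Sphere models (Hatcher VBKT §2.3). [folklore] -/
@[simp] theorem sphereHomeoOfEquiv_apply_coe (L : E ≃L[ℝ] F) (x : sphere (0 : E) 1) :
    ((sphereHomeoOfEquiv L x : sphere (0 : F) 1) : F) = nrmz (L x) := rfl

/-- Re-dimensioning a round sphere along an equality of dimensions. [folklore] -/
def sphereCastHomeo {a b : ℕ} (h : a = b) :
    sphere (0 : EuclideanSpace ℝ (Fin (a + 1))) 1 ≃ₜ sphere (0 : EuclideanSpace ℝ (Fin (b + 1))) 1 := h ▸ Homeomorph.refl _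

/-- Sphere models (Hatcher VBKT §2.3). [folklore] -/
@[simp] theorem sphereCastHomeo_pole {a b : ℕ} (h : a = b) : sphereCastHomeo h (pole a) = pole b := by
  subst h; rfl

end Radial

/-! ### 2. Base-point independence of the reduced group -/

section BasePoint

universe u

variable {X : Type u} [TopologicalSpace X]

/-- A path gives a homotopy between the two point inclusions. [folklore] -/
def constHomotopyOfPath {x₀ x₁ : X} (γ : Path x₀ x₁) :
    (ContinuousMap.const PUnit.{u + 1} x₀).Homotopy (ContinuousMap.const PUnit.{u + 1} x₁) where
  toFun p := γ p.1
  continuous_toFun := γ.continuous.comp continuous_fst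
  map_zero_left _ := γ.source
  map_one_left _ := γ.target

/-- **Joined base points have the same rank functional.** [folklore] -/
theorem rankAt_eq_of_joined {x₀ x₁ : X} (h : Joined x₀ x₁) (a : K0 X) : rankAt x₀ a = rankAt x₁ a := by
  obtain ⟨γ⟩ := h
  have hh : (ContinuousMap.const PUnit.{u + 1} x₀).Homotopic (ContinuousMap.const PUnit.{u + 1} x₁) := ⟨constHomotopyOfPath γ⟩
  have h1 := congrArg (fun f : K0 X →+ K0 PUnit.{u + 1} ↦ rankAt PUnit.unit (f a)) (pullback_eq_of_homotopic hh)
  simp only [rankAt_pullback] at h1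
  exact h1

/-- **The reduced group does not depend on the base point within a path component.** [folklore] -/
theorem reduced_eq_of_joined {x₀ x₁ : X} (h : Joined x₀ x₁) : Reduced X x₀ = Reduced X x₁ := by
  ext a; rw [mem_reduced_iff, mem_reduced_iff, rankAt_eq_of_joined h]

/-- On a path-connected compact space the reduced group is independent of the base point. [folklore] -/
theorem reduced_eq_of_pathConnectedSpace [PathConnectedSpace X] (x₀ x₁ : X) : Reduced X x₀ = Reduced X x₁ :=
  reduced_eq_of_joined (PathConnectedSpace.joined x₀ x₁)

/-- Round spheres of positive dimension are path connected. [folklore] -/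
instance pathConnectedSpace_roundSphere (n : ℕ) : PathConnectedSpace (sphere (0 : EuclideanSpace ℝ (Fin (n + 2))) 1) := by
  rw [← isPathConnected_iff_pathConnectedSpace]
  refine isPathConnected_sphere ?_ 0 zero_le_one
  rw [← Module.finrank_eq_rank, finrank_euclideanSpace_fin]
  exact_mod_cast (by omega : 1 < n + 2)

/-- `K̃(S²ᵐ⁺¹) = 0` at every base point. [cite: HatcherVBKT2017, §2.1 Cor. 2.12] -/
theorem reduced_odd_sphere_eq_bot' (m : ℕ) (x₀ : sphere (0 : EuclideanSpace ℝ (Fin (2 * m + 1 + 1))) 1) :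
    Reduced (sphere (0 : EuclideanSpace ℝ (Fin (2 * m + 1 + 1))) 1) x₀ = ⊥ := by
  rw [reduced_eq_of_pathConnectedSpace x₀ (pole (2 * m + 1))]
  exact reduced_sphere_odd_eq_bot m

end BasePoint

/-! ### 3. `∂(Dᵈ × Dᵈ) ≅ S²ᵈ⁻¹` and `K̃(∂(Dᵈ × Dᵈ)) = 0` -/

section Boundary

variable {d : ℕ}

/-- `∂(Dᵈ × Dᵈ)` is the unit sphere of `ℝᵈ × ℝᵈ` for the sup norm. [folklore] -/
def bdryHomeoSupSphere : ↥(bdry d) ≃ₜ sphere (0 : Vd d × Vd d) 1 where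
  toFun w := ⟨(((w : DD d).1 : Vd d), ((w : DD d).2 : Vd d)), mem_sphere_zero_iff_norm.2 (by rw [Prod.norm_def]; exact w.2)⟩
  invFun x := ⟨(⟨(x : Vd d × Vd d).1, mem_closedBall_zero_iff.2 ((norm_fst_le (x : Vd d × Vd d)).trans (mem_sphere_zero_iff_norm.1 x.2).le)⟩,
      ⟨(x : Vd d × Vd d).2, mem_closedBall_zero_iff.2 ((norm_snd_le (x : Vd d × Vd d)).trans (mem_sphere_zero_iff_norm.1 x.2).le)⟩),
    show max _ _ = 1 by rw [← Prod.norm_def]; exact mem_sphere_zero_iff_norm.1 x.2⟩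
  left_inv _ := rfl
  right_inv _ := rfl
  continuous_toFun := ((continuous_subtype_val.comp (continuous_fst.comp continuous_subtype_val)).prodMk
    (continuous_subtype_val.comp (continuous_snd.comp continuous_subtype_val))).subtype_mk _
  continuous_invFun := (((continuous_fst.comp continuous_subtype_val).subtype_mk _).prodMk
    ((continuous_snd.comp continuous_subtype_val).subtype_mk _)).subtype_mk _

/-- Sphere models (Hatcher VBKT §2.3). [folklore] -/
theorem finrank_Vd_prod : finrank ℝ (Vd d × Vd d) = finrank ℝ (EuclideanSpace ℝ (Fin (d + d))) := by
  rw [Module.finrank_prod, finrank_euclideanSpace_fin, finrank_euclideanSpace_fin]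

/-- **`∂(Dᵈ × Dᵈ) ≃ₜ S²ᵈ⁻¹`** (sup-sphere to the round sphere by radial projection). [cite: HatcherVBKT2017, §2.3] -/
def bdryHomeoRound : ↥(bdry d) ≃ₜ sphere (0 : EuclideanSpace ℝ (Fin (d + d))) 1 :=
  bdryHomeoSupSphere.trans (sphereHomeoOfEquiv (ContinuousLinearEquiv.ofFinrankEq finrank_Vd_prod))

/-- **`K̃(∂(Dᵈ × Dᵈ)) = 0`** for `d ≥ 1` (it is an odd-dimensional sphere). [cite: HatcherVBKT2017, §2.3 proof of Thm. 2.19] -/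
theorem reduced_bdry_eq_bot (hd : 0 < d) (w₀ : ↥(bdry d)) : Reduced (↥(bdry d)) w₀ = ⊥ := by
  obtain ⟨m, rfl⟩ : ∃ m, d = m + 1 := ⟨d - 1, by omega⟩
  have h : m + 1 + (m + 1) = 2 * m + 1 + 1 := by ring
  set φ : ↥(bdry (m + 1)) ≃ₜ sphere (0 : EuclideanSpace ℝ (Fin (2 * m + 1 + 1))) 1 :=
    bdryHomeoRound.trans (h ▸ Homeomorph.refl (sphere (0 : EuclideanSpace ℝ (Fin (m + 1 + (m + 1)))) 1))
  exact reduced_eq_bot_of_homeomorph φ w₀ (reduced_odd_sphere_eq_bot' m (φ w₀))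

end Boundary

/-! ### 4. The bottom sphere: `Sᵈ ≅` round `Sᵈ ≅` the equator of `Sᵈ⁺¹`; stable null-homotopy -/

section Bottom

variable {d : ℕ}

/-- Sphere models (Hatcher VBKT §2.3). [folklore] -/
theorem finrank_Wd : finrank ℝ (Wd d) = finrank ℝ (EuclideanSpace ℝ (Fin (d + 1))) := by
  rw [(WithLp.linearEquiv 2 ℝ (Vd d × ℝ)).finrank_eq, Module.finrank_prod, finrank_euclideanSpace_fin, Module.finrank_self,
    finrank_euclideanSpace_fin]

/-- **`Sᵈ ≃ₜ` round `Sᵈ`.** [folklore] -/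
def swHomeoRound : SW d ≃ₜ sphere (0 : EuclideanSpace ℝ (Fin (d + 1))) 1 :=
  sphereHomeoOfEquiv (ContinuousLinearEquiv.ofFinrankEq finrank_Wd)

/-- The hyperplane orthogonal to the last axis. [folklore] -/
abbrev lastHyp (d : ℕ) : Submodule ℝ (EuclideanSpace ℝ (Fin (d + 2))) := (Submodule.span ℝ {lastAxis d})ᗮ

/-- Sphere models (Hatcher VBKT §2.3). [folklore] -/
theorem finrank_lastHyp : finrank ℝ (EuclideanSpace ℝ (Fin (d + 1))) = finrank ℝ ↥(lastHyp d) := by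
  haveI : Fact (finrank ℝ (EuclideanSpace ℝ (Fin (d + 2))) = d + 1 + 1) := ⟨by simp⟩
  rw [Submodule.finrank_orthogonal_span_singleton (n := d + 1) lastAxis_ne_zero, finrank_euclideanSpace_fin]

open RealInnerProductSpace in
/-- The equator is the zero set of the last coordinate functional. [folklore] -/
theorem mem_equator_iff_inner {x : Sph d} : x ∈ equator d ↔ ⟪((x : Sph d) : EuclideanSpace ℝ (Fin (d + 2))), lastAxis d⟫ = 0 := by
  change (0 ≤ ⟪((x : Sph d) : EuclideanSpace ℝ (Fin (d + 2))), lastAxis d⟫ ∧ 0 ≤ ⟪((x : Sph d) : EuclideanSpace ℝ (Fin (d + 2))), -lastAxis d⟫) ↔ _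
  rw [inner_neg_right, neg_nonneg]
  constructor
  · rintro ⟨h1, h2⟩; exact le_antisymm h2 h1
  · intro h; rw [h]; exact ⟨le_rfl, le_rfl⟩

open RealInnerProductSpace in
/-- A unit vector of the hyperplane, as a point of the equator. [folklore] -/
def hypToEquator (y : sphere (0 : ↥(lastHyp d)) 1) : ↥(equator d) :=
  ⟨⟨((y : ↥(lastHyp d)) : EuclideanSpace ℝ (Fin (d + 2))), by
      rw [mem_sphere_zero_iff_norm]; exact mem_sphere_zero_iff_norm.1 y.2⟩,
    mem_equator_iff_inner.2 ((Submodule.mem_orthogonal_singleton_iff_inner_left).1 (y : ↥(lastHyp d)).2)⟩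

open RealInnerProductSpace in
/-- A point of the equator, as a unit vector of the hyperplane. [folklore] -/
def equatorToHyp (x : ↥(equator d)) : sphere (0 : ↥(lastHyp d)) 1 :=
  ⟨⟨((x : Sph d) : EuclideanSpace ℝ (Fin (d + 2))),
      (Submodule.mem_orthogonal_singleton_iff_inner_left).2 (mem_equator_iff_inner.1 x.2)⟩, by
    rw [mem_sphere_zero_iff_norm]; exact mem_sphere_zero_iff_norm.1 x.1.2⟩

/-- **The unit sphere of the hyperplane is the equator.** [folklore] -/
def hypSphereHomeoEquator : sphere (0 : ↥(lastHyp d)) 1 ≃ₜ ↥(equator d) where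
  toFun := hypToEquator
  invFun := equatorToHyp
  left_inv _ := rfl
  right_inv _ := rfl
  continuous_toFun := ((continuous_subtype_val.comp continuous_subtype_val).subtype_mk _).subtype_mk _
  continuous_invFun := ((continuous_subtype_val.comp continuous_subtype_val).subtype_mk _).subtype_mk _

/-- **`Sᵈ ≃ₜ` the equator of `Sᵈ⁺¹`.** [folklore] -/
def swHomeoEquator : SW d ≃ₜ ↥(equator d) :=
  swHomeoRound.trans ((sphereHomeoOfEquiv (ContinuousLinearEquiv.ofFinrankEq finrank_lastHyp)).trans hypSphereHomeoEquator)

/-- **Invertible matrix-valued maps on `Sᵈ`, `d` even, are stably null-homotopic through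
invertible matrices** (from `K̃(Sᵈ⁺¹) = 0` and the clutching classification over `Sᵈ⁺¹`,
`ClutchingStablyTrivial.lean`, transported from the equator). [cite: HatcherVBKT2017, §1.2 Prop. 1.11] -/
theorem stablyNullhomotopic_even (m : ℕ) : StablyNullhomotopic (2 * m + 2) := by
  intro N F hF
  set φ : SW (2 * m + 2) ≃ₜ ↥(equator (2 * m + 2)) := swHomeoEquator with hφ
  set G : C(↥(equator (2 * m + 2)), Matrix (Fin N) (Fin N) ℂ) := F.comp (φ.symm : C(↥(equator (2 * m + 2)), SW (2 * m + 2))) with hG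
  have hG' : ∀ z, IsUnit (G z).det := fun z ↦ hF _
  have hK : Reduced (Sph (2 * m + 2)) (pole (2 * (m + 1) + 1)) = ⊥ := reduced_sphere_odd_eq_bot (m + 1)
  obtain ⟨a, H, hHu⟩ := exists_homotopy_blockOneFamily_of_reduced_eq_bot hK G hG'
  refine ⟨a, ⟨fun z ↦ H (unitInterval.symm z.2, φ z.1), H.continuous.comp ((unitInterval.continuous_symm.comp continuous_snd).prodMk
    (φ.continuous.comp continuous_fst))⟩, ?_, ?_, ?_⟩
  · intro q
    change H (unitInterval.symm 0, φ q) = 1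
    rw [unitInterval.symm_zero, H.apply_one]; rfl
  · intro q
    change H (unitInterval.symm 1, φ q) = _
    rw [unitInterval.symm_one, H.apply_zero, blockOneFamily_apply, hG, ContinuousMap.comp_apply]
    congr 2
    exact φ.symm_apply_apply q
  · intro z; exact hHu _

end Bottom

/-! ### 5. The top cell `(Dᵈ × Dᵈ)/∂ ≅ S²ᵈ` -/

section TopCell

variable {d : ℕ}

/-- The open bidisc `{rad < 1}`. [folklore] -/
def openDD (d : ℕ) : Set (DD d) := {w | rad w < 1}

/-- Sphere models (Hatcher VBKT §2.3). [folklore] -/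
theorem isOpen_openDD : IsOpen (openDD d) := isOpen_lt continuous_rad continuous_const

/-- Sphere models (Hatcher VBKT §2.3). [folklore] -/
theorem mem_openDD {w : DD d} : w ∈ openDD d ↔ rad w < 1 := Iff.rfl

/-- Sphere models (Hatcher VBKT §2.3). [folklore] -/
theorem disjoint_openDD_bdry : Disjoint (openDD d) (bdryC d : Set (DD d)) := by
  rw [Set.disjoint_left]; intro w hw hb; rw [mem_openDD] at hw; rw [coe_bdryC, mem_bdry] at hb; linarith

/-- The open bidisc is the product of two open balls. [folklore] -/
def openDDHomeoBalls : ↥(openDD d) ≃ₜ ↥(ball (0 : Vd d) 1) × ↥(ball (0 : Vd d) 1) where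
  toFun w := (⟨(((w : DD d).1 : Vd d)), mem_ball_zero_iff.2 ((norm_fst_le_rad _).trans_lt w.2)⟩,
    ⟨(((w : DD d).2 : Vd d)), mem_ball_zero_iff.2 ((norm_snd_le_rad _).trans_lt w.2)⟩)
  invFun p := ⟨(⟨(p.1 : Vd d), ball_subset_closedBall p.1.2⟩, ⟨(p.2 : Vd d), ball_subset_closedBall p.2.2⟩),
    max_lt (mem_ball_zero_iff.1 p.1.2) (mem_ball_zero_iff.1 p.2.2)⟩
  left_inv _ := rfl
  right_inv _ := rfl
  continuous_toFun := ((continuous_subtype_val.comp (continuous_fst.comp continuous_subtype_val)).subtype_mk _).prodMk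
    ((continuous_subtype_val.comp (continuous_snd.comp continuous_subtype_val)).subtype_mk _)
  continuous_invFun := (((continuous_subtype_val.comp continuous_fst).subtype_mk _).prodMk
    ((continuous_subtype_val.comp continuous_snd).subtype_mk _)).subtype_mk _

/-- The open bidisc is homeomorphic to `ℝᵈ × ℝᵈ`. [folklore] -/
def openDDHomeoPlane : ↥(openDD d) ≃ₜ Vd d × Vd d :=
  openDDHomeoBalls.trans ((Homeomorph.unitBall (E := Vd d)).symm.prodCongr (Homeomorph.unitBall (E := Vd d)).symm)

/-- The interior of the cell embeds openly into the quotient `(Dᵈ × Dᵈ)/∂`. [folklore] -/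
theorem isOpenEmbedding_mk_openDD : IsOpenEmbedding fun w : ↥(openDD d) ↦ Collapse.mk (bdryC d) (w : DD d) := by
  refine IsOpenEmbedding.of_continuous_injective_isOpenMap ((Collapse.mk (bdryC d)).continuous.comp continuous_subtype_val) ?_ ?_
  · intro w w' h
    rcases (Collapse.mk_eq_mk_iff (A := bdryC d)).1 h with h' | ⟨h', -⟩
    · exact Subtype.ext h'
    · exact absurd h' (Set.disjoint_left.1 disjoint_openDD_bdry w.2)
  · intro U hU
    have h1 : (fun w : ↥(openDD d) ↦ Collapse.mk (bdryC d) (w : DD d)) '' U = Collapse.mk (bdryC d) '' (Subtype.val '' U) := (image_image _ _ _).symm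
    rw [h1]
    refine Collapse.isOpen_image_mk (isOpen_openDD.isOpenMap_subtype_val U hU) ?_
    exact Set.disjoint_of_subset_left (by rintro _ ⟨w, -, rfl⟩; exact w.2) disjoint_openDD_bdry

/-- The range of the interior in the quotient is the complement of the base point. [folklore] -/
theorem range_mk_openDD : range (fun w : ↥(openDD d) ↦ Collapse.mk (bdryC d) (w : DD d)) = {Collapse.pt (bdryC d)}ᶜ := by
  ext z
  constructor
  · rintro ⟨w, rfl⟩ h
    exact Set.disjoint_left.1 disjoint_openDD_bdry w.2 ((Collapse.mk_eq_pt_iff (A := bdryC d)).1 h)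
  · intro hz
    rcases Collapse.eq_pt_or_eq_mk z with rfl | ⟨w, hw, rfl⟩
    · exact absurd rfl hz
    · refine ⟨⟨w, ?_⟩, rfl⟩
      have hw' : rad w ≠ 1 := hw
      exact lt_of_le_of_ne (rad_le_one w) hw'

/-- `OnePoint` of the open bidisc is the quotient `(Dᵈ × Dᵈ)/∂`, `∞ ↦ pt`. [folklore] -/
def onePointOpenDDHomeo : OnePoint ↥(openDD d) ≃ₜ Collapse (DD d) (bdryC d) :=
  OnePoint.equivOfIsEmbeddingOfRangeEq (Collapse.pt (bdryC d)) _ isOpenEmbedding_mk_openDD.isEmbedding range_mk_openDD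

/-- Sphere models (Hatcher VBKT §2.3). [folklore] -/
@[simp] theorem onePointOpenDDHomeo_infty : onePointOpenDDHomeo (d := d) OnePoint.infty = Collapse.pt (bdryC d) := rfl

/-- Sphere models (Hatcher VBKT §2.3). [folklore] -/
theorem finrank_plane : finrank ℝ (Vd d × Vd d) = d + d := by
  rw [Module.finrank_prod, finrank_euclideanSpace_fin]

/-- **The top cell of the cone is a round sphere: `(Dᵈ × Dᵈ)/∂ ≃ₜ S²ᵈ`, base point to the pole.** [cite: HatcherVBKT2017, §2.3 proof of Thm. 2.19] -/
def topCellHomeo : Collapse (DD d) (bdryC d) ≃ₜ sphere (0 : EuclideanSpace ℝ (Fin (d + d + 1))) 1 :=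
  onePointOpenDDHomeo.symm.trans ((openDDHomeoPlane (d := d)).onePointCongr.trans (onePointHomeoSphere (Vd d × Vd d) (d + d) finrank_plane))

/-- Sphere models (Hatcher VBKT §2.3). [folklore] -/
@[simp] theorem topCellHomeo_pt : topCellHomeo (Collapse.pt (bdryC d)) = pole (d + d) := by
  rw [topCellHomeo, Homeomorph.trans_apply, Homeomorph.trans_apply]
  have h1 : (onePointOpenDDHomeo (d := d)).symm (Collapse.pt (bdryC d)) = OnePoint.infty := by
    rw [Homeomorph.symm_apply_eq]; rfl
  rw [h1]
  rfl

end TopCell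

end Literature.AlgebraicTopology.KTheory

end
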